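import Literature.NumberTheory.EllipticCurves.Wuthrich2014.RankOneEngineProofs
import HarnessLib

/-!
# Rank ONE at a reducible good ordinary prime `p ≥ 5`, part 2: `ord_p #Ш ≤ ord_p #Ш_an`, and
# Mazur's main conjecture ⟺ `BSD(E,p)`, modulo Schneider's non-degeneracy (Miller's currency)

`Proofs` companion (theorems only; no new definition, no new named fact — D-0014/D-0026) of
`Wuthrich2014.ReducibleDivisibility` (C. Wuthrich, Doc. Math. 19 (2014), Thm. 16), `IwasawaLeadingTerm`
(Perrin-Riou–Schneider as printed by Balakrishnan–Müller–Stein, Math. Comp. 85 (2016), Thm. 1.7) and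
`PAdicGrossZagier` (B. Perrin-Riou, Invent. Math. 89 (1987), §1.4 Cor. 1.8); continuation of
`Wuthrich2014/RankOneEngineProofs.lean` (the engine `exists_cofactor_of_mem_charIdeal_of_rank_one`).
HONEST FRAMING (BSD rank-≤1 residual cell `b2b-bsdres`, unit `b2b-bsdres-x1b`, prover B, GEN 3,
independent patchwork — no Keller–Yin input anywhere): the cell deletes the COMBINATION-SHAPED residual
classes of the rank-`≤ 1` BSD formula STRICTLY from published theorems and TYPES the remainder; this is
not "finishing BSD".

Setting throughout: `W` a globally minimal model of `E/ℚ`, `p ≥ 5` a prime of good ordinary reduction,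
`ord_{s=1} L(E,s) = 1`, and the per-curve CERTIFICATE `hSch`: Schneider's non-degeneracy `Reg_p(E) ≠ 0`
for THE canonical cyclotomic `p`-adic height (⟺ `[T¹]L_p(f,α) ≠ 0`,
`coeff_one_padicLFunction_ne_zero_iff_schneider`; a `p`-adic computation that certifies itself when
true — Stein–Wuthrich 2013 §§3–4). Published named facts: Wuthrich Thm. 16 (`hW16`, needs `E[p]`
reducible), Perrin-Riou–Schneider (`hS`), Perrin-Riou 1987 (`hPR`), modularity with an integral Manin
constant (`hmod`), Gross–Zagier–Kolyvagin (`hGZK`).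

* `missingUpperBoundAt_of_rank_one` — `ord_p #Ш(E/ℚ) ≤ ord_p #Ш(E/ℚ)_an` (`Typed.MissingUpperBoundAt`):
  the rank-one counterpart of Wuthrich's Prop. 21 and the classical form of gen 1's
  `padicBSD_inequality_of_charIdeal_dvd`;
* `mainConjecture_of_missingLowerBoundAt_of_rank_one` — the reverse inequality forces the Kato–Wuthrich
  cofactor to be a unit, i.e. Mazur's main conjecture for `(E,p)` (Néron normalisation, every datum; body
  of prover A's `MazurMainConjecture W p`) — rank-one analogue of gen 2's converse;
* `missingPPartAt_of_mainConjecture_of_rank_one` — NO Wuthrich input: main conjecture + Perrin-Riou–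
  Schneider + Perrin-Riou + GZK ⟹ `ord_p #Ш_an = ord_p #Ш` (Perrin-Riou 1987 Cor. 1.8–1.9's deduction;
  used with Greenberg–Vatsal 2000 Thm. 1.3 for the sub-class B1 = X1 ∧ {r = 1} ∧ gvpar in
  `Rank1Residual/X1RankOne.lean`);
* `mainConjecture_iff_missingPPartAt_of_rank_one`, `mainConjecture_iff_bsdp_of_rank_one` — on this locus
  Mazur's main conjecture, the typed output `MissingPPartAt W p` and Miller's `BSDp W p` are ONE statement;
* `bsdp_and_mainConjecture_of_rank_one_of_shaAn_unit` — if `p ∤ #Ш(E/ℚ)_an` (all 259 rank-one X1 census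
  pairs, `N < 10⁴`) the certificate alone yields `BSD(E,p)` AND the main conjecture: the per-curve lever is
  the `p`-adic computation `[T¹]L_p ≠ 0`, not a descent.

Not covered: `p = 3` (the tree's Perrin-Riou–Schneider, Perrin-Riou and canonical-height facts carry
`5 ≤ p`; 235 of the 259 rank-one X1 census pairs are at `p = 3`); the certificate itself (Schneider's
conjecture, open; Bertrand 1982 for CM only).

References: [Wuthrich2014] Thm. 16 (p. 393), §6 (p. 400); [PerrinRiou1987] Thm. 1.3, §1.4 Cor. 1.8;
[BalakrishnanMullerStein2015] Thm. 1.7; [SteinWuthrich2013] §§3–4, §9; [GreenbergLNM1716] §5;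
[Miller2011LMS] Def. 1.1.
-/

set_option autoImplicit false

noncomputable section

open scoped Classical MatrixGroups ModularForm

open CongruenceSubgroup WeierstrassCurve Literature.NumberTheory.EllipticCurves
  Literature.NumberTheory.EllipticCurves.ModularForms
  Literature.NumberTheory.EllipticCurves.Rank1Residual

namespace Literature.NumberTheory.EllipticCurves.Wuthrich2014

/-! ### Consequences in Miller's currency -/

/-- **Rank one, the published half: `ord_p #Ш(E/ℚ) ≤ ord_p #Ш(E/ℚ)_an`** (`Typed.MissingUpperBoundAt`)
at a reducible good ordinary `p ≥ 5` with `ord_{s=1} L(E,s) = 1`, MODULO the per-curve certificate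
"Schneider's non-degeneracy for the canonical `p`-adic height" (`hSch`; ⟺ `[T¹]L_p ≠ 0`). Published
inputs: Wuthrich 2014 Thm. 16 (`hW16`, `g ∈ char_Λ X` with `ι g = ϖ L_p`), Perrin-Riou–Schneider
(`hS`), Perrin-Riou 1987 (`hPR`), modularity with an integral Manin constant (`hmod`, for the newform
and `ϖ`), Gross–Zagier–Kolyvagin (`hGZK`). The defect is `ord_p h(0) ≥ 0` for the Kato–Wuthrich
cofactor `h`. This is the rank-one counterpart of Wuthrich's Prop. 21 (rank `0`) and the classical
form of `padicBSD_inequality_of_charIdeal_dvd`. [cite: Wuthrich2014, Thm. 16 (p. 393) and §6 (p. 400)]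
[cite: PerrinRiou1987, §1.4 Cor. 1.8] [cite: BalakrishnanMullerStein2015, Thm. 1.7] -/
theorem missingUpperBoundAt_of_rank_one (hW16 : charIdeal_dvd_padicLFunction)
    (hS : Schneider1985_order_charGenerator) (hPR : perrinRiou_rankOne_leadingTerms)
    (hmod : nonempty_modularParametrizationData)
    (hGZK : rank_eq_analyticRank_of_analyticRank_le_one)
    (W : WeierstrassCurve ℚ) [W.IsElliptic] [W.IsGloballyMinimal] (p : ℕ) [Fact p.Prime]
    (hp : 5 ≤ p) (hgood : W.HasGoodReductionAtPrime p) (hordp : ¬ (p : ℤ) ∣ W.frobeniusTrace p)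
    (hred : ¬ W.HasIrreducibleModPGaloisRep p) (han : W.analyticRank = 1)
    (hSch : ∀ Dh : PAdicHeightData W p, Dh.IsCanonical → SchneiderConjecture Dh) :
    Typed.MissingUpperBoundAt W p := by
  obtain ⟨κ, hκ, γ, hγ, hγ'⟩ := exists_isCyclotomic_isTopGenerator_isCyclotomicVariable_holds p
  obtain ⟨D⟩ := W.nonempty_selmerDualData_holds κ γ hγ
  haveI : NeZero (W.conductorNorm ℤ) := ⟨(W.conductorNorm_pos_holds).ne'⟩
  obtain ⟨Dm⟩ := hmod W
  obtain ⟨ϖ, -, hϖ, -⟩ := Dm.exists_rat_mul_realPeriodRat_eq_plusPeriod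
  obtain ⟨Dh, hDh, -⟩ := existsUnique_isCanonical_holds W p hp hgood hordp
  have hordin : IsOrdinaryAt W p := ⟨hgood, hordp⟩
  obtain ⟨hX, g, hgmem, hιg⟩ := hW16 W p (by omega) hordin hred hκ hγ hγ' Dm.isNewformOf D ϖ hϖ
  obtain ⟨fE, h, s, -, -, -, -, hsha, -, hval⟩ := exists_cofactor_of_mem_charIdeal_of_rank_one hS hPR
    hGZK W p hp hgood hordp han hκ hγ hγ' Dm.isNewformOf ϖ hϖ Dh hDh (hSch Dh hDh) D hX g hgmem hιg
  refine ⟨s, hsha, ?_⟩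
  have h0 : 0 ≤ (((PowerSeries.constantCoeff h : ℤ_[p]) : ℚ_[p])).valuation :=
    PadicInt.valuation_coe_nonneg
  rw [hval]
  linarith

/-- **Rank one: the reverse inequality forces Mazur's main conjecture.** Same setting; if moreover
`ord_p #Ш(E/ℚ)_an ≤ ord_p #Ш(E/ℚ)` (`Typed.MissingLowerBoundAt W p`), then `ord_p h(0) = 0`, the
cofactor `h` is a unit of `Λ = ℤ_p⟦T⟧` (`PowerSeries.isUnit_iff_constantCoeff`), and
`char_Λ X = (f_E) = (g)` with `ι g = ϖ · L_p(f, α)` — Mazur's main conjecture for `(E,p)` in the Néron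
normalisation, at every datum `(κ, γ, f, ϖ, D)` (body of prover A's `MazurMainConjecture W p`). The
rank-one analogue of `mainConjecture_of_missingLowerBoundAt`. [cite: Wuthrich2014, Thm. 16 (p. 393) and §6]
[cite: PerrinRiou1987, §1.4 Cor. 1.8] [cite: BalakrishnanMullerStein2015, Thm. 1.7]
[cite: GreenbergLNM1716, §5 (closing examples)] -/
theorem mainConjecture_of_missingLowerBoundAt_of_rank_one (hW16 : charIdeal_dvd_padicLFunction)
    (hS : Schneider1985_order_charGenerator) (hPR : perrinRiou_rankOne_leadingTerms)
    (hGZK : rank_eq_analyticRank_of_analyticRank_le_one)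
    (W : WeierstrassCurve ℚ) [W.IsElliptic] [W.IsGloballyMinimal] (p : ℕ) [Fact p.Prime]
    (hp : 5 ≤ p) (hgood : W.HasGoodReductionAtPrime p) (hordp : ¬ (p : ℤ) ∣ W.frobeniusTrace p)
    (hred : ¬ W.HasIrreducibleModPGaloisRep p) (han : W.analyticRank = 1)
    (hSch : ∀ Dh : PAdicHeightData W p, Dh.IsCanonical → SchneiderConjecture Dh)
    (hlow : Typed.MissingLowerBoundAt W p)
    {κ : ZpExtension ℚ p} {γ : Field.absoluteGaloisGroup ℚ} {N : ℕ} [NeZero N]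
    {f : CuspForm (Gamma0 N) 2} (hκ : κ.IsCyclotomic) (hγ : κ.IsTopGenerator γ)
    (hγ' : IsCyclotomicVariable p γ) (hf : IsNewformOf W f) (D : W.SelmerDualData κ γ) (ϖ : ℚ)
    (hϖ : (ϖ : ℝ) * W.realPeriodRat = plusPeriod f) :
    D.IsTorsion ∧ ∃ g : IwasawaAlgebra p, D.charIdeal = Ideal.span {g} ∧
      iwasawaToPowerSeries p g =
        PowerSeries.C ((ϖ : ℚ) : ℚ_[p]) * padicLFunction f (unitRoot W p : ℚ_[p]) := by
  obtain ⟨Dh, hDh, -⟩ := existsUnique_isCanonical_holds W p hp hgood hordp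
  have hordin : IsOrdinaryAt W p := ⟨hgood, hordp⟩
  obtain ⟨hX, g, hgmem, hιg⟩ := hW16 W p (by omega) hordin hred hκ hγ hγ' hf D ϖ hϖ
  obtain ⟨fE, h, s, hchar, -, hgh, hh0, hsha, -, hval⟩ :=
    exists_cofactor_of_mem_charIdeal_of_rank_one hS hPR hGZK W p hp hgood hordp han hκ hγ hγ' hf ϖ hϖ
      Dh hDh (hSch Dh hDh) D hX g hgmem hιg
  obtain ⟨s', hs', hle⟩ := hlow
  have hss : s' = s := by exact_mod_cast hs'.symm.trans hsha
  rw [hss, hval] at hle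
  have hnn : 0 ≤ (((PowerSeries.constantCoeff h : ℤ_[p]) : ℚ_[p])).valuation :=
    PadicInt.valuation_coe_nonneg
  have hv0 : (((PowerSeries.constantCoeff h : ℤ_[p]) : ℚ_[p])).valuation = 0 := by linarith
  have hvalh : (PowerSeries.constantCoeff h : ℤ_[p]).valuation = 0 := by
    have h' := hv0
    rw [PadicInt.valuation_coe] at h'
    exact_mod_cast h'
  have hunit0 : IsUnit (PowerSeries.constantCoeff h : ℤ_[p]) := by
    rw [PadicInt.isUnit_iff, PadicInt.norm_eq_zpow_neg_valuation hh0, hvalh]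
    simp
  have hunit : IsUnit h := PowerSeries.isUnit_iff_constantCoeff.mpr hunit0
  refine ⟨hX, g, ?_, hιg⟩
  rw [hchar, hgh, Ideal.span_singleton_mul_left_unit hunit]

/-- **Rank one: Mazur's main conjecture ⟹ `ord_p #Ш(E/ℚ)_an = ord_p #Ш(E/ℚ)`** (`Typed.MissingPPartAt`)
at a good ordinary `p ≥ 5` with `ord_{s=1} L(E,s) = 1`, modulo the Schneider certificate — with NO
Wuthrich/Kato input: the main conjecture (`hMC`, Néron normalisation, newform at level `N_E`) supplies a
generator `g` of `char_Λ X` with `ι g = ϖ L_p`; the engine's cofactor is then a unit, so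
`ord_p #Ш_an = ord_p #Ш`. Inputs: Perrin-Riou–Schneider (`hS`), Perrin-Riou 1987 (`hPR`), modularity
(`hmod`), Gross–Zagier–Kolyvagin (`hGZK`). This is the deduction "main conjecture + non-degenerate
`p`-adic height ⟹ `p`-part of BSD in rank one" (Perrin-Riou 1987 §1.4 Cor. 1.8–1.9; Schneider 1985),
any image of `ρ̄_{E,p}`. [cite: PerrinRiou1987, §1.4 Cor. 1.8] [cite: BalakrishnanMullerStein2015, Thm. 1.7]
[cite: SteinWuthrich2013, §9] -/
theorem missingPPartAt_of_mainConjecture_of_rank_one (hS : Schneider1985_order_charGenerator)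
    (hPR : perrinRiou_rankOne_leadingTerms) (hmod : nonempty_modularParametrizationData)
    (hGZK : rank_eq_analyticRank_of_analyticRank_le_one)
    (W : WeierstrassCurve ℚ) [W.IsElliptic] [W.IsGloballyMinimal] (p : ℕ) [Fact p.Prime]
    (hp : 5 ≤ p) (hgood : W.HasGoodReductionAtPrime p) (hordp : ¬ (p : ℤ) ∣ W.frobeniusTrace p)
    (han : W.analyticRank = 1)
    (hSch : ∀ Dh : PAdicHeightData W p, Dh.IsCanonical → SchneiderConjecture Dh)
    (hMC : ∀ (κ : ZpExtension ℚ p) (γ : Field.absoluteGaloisGroup ℚ),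
        κ.IsCyclotomic → κ.IsTopGenerator γ → IsCyclotomicVariable p γ →
      ∀ [NeZero (W.conductorNorm ℤ)] (f : CuspForm (Gamma0 (W.conductorNorm ℤ)) 2),
        IsNewformOf W f → ∀ (ϖ : ℚ), (ϖ : ℝ) * W.realPeriodRat = plusPeriod f →
      ∀ (D : W.SelmerDualData κ γ), D.IsTorsion ∧
        ∃ g : IwasawaAlgebra p, D.charIdeal = Ideal.span {g} ∧
          iwasawaToPowerSeries p g =
            PowerSeries.C (ϖ : ℚ_[p]) * padicLFunction f (unitRoot W p : ℚ_[p])) :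
    Typed.MissingPPartAt W p := by
  obtain ⟨κ, hκ, γ, hγ, hγ'⟩ := exists_isCyclotomic_isTopGenerator_isCyclotomicVariable_holds p
  obtain ⟨D⟩ := W.nonempty_selmerDualData_holds κ γ hγ
  haveI : NeZero (W.conductorNorm ℤ) := ⟨(W.conductorNorm_pos_holds).ne'⟩
  obtain ⟨Dm⟩ := hmod W
  obtain ⟨ϖ, -, hϖ, -⟩ := Dm.exists_rat_mul_realPeriodRat_eq_plusPeriod
  obtain ⟨Dh, hDh, -⟩ := existsUnique_isCanonical_holds W p hp hgood hordp
  obtain ⟨hX, g, hchar_g, hιg⟩ := hMC κ γ hκ hγ hγ' Dm.f Dm.isNewformOf ϖ hϖ D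
  obtain ⟨fE, h, s, hchar, hfE0, hgh, -, hsha, -, hval⟩ :=
    exists_cofactor_of_mem_charIdeal_of_rank_one hS hPR hGZK W p hp hgood hordp han hκ hγ hγ'
      Dm.isNewformOf ϖ hϖ Dh hDh (hSch Dh hDh) D hX g
      (by rw [hchar_g]; exact Ideal.mem_span_singleton_self g) hιg
  -- `(g) = char_Λ X = (fE)` and `g = h · fE` with `fE ≠ 0`: `h` is a unit
  have hspan : Ideal.span {g} = Ideal.span {fE} := hchar_g.symm.trans hchar
  obtain ⟨v, hv⟩ := Ideal.span_singleton_eq_span_singleton.mp hspan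
  have hhv : h * (v : IwasawaAlgebra p) = 1 := by
    apply mul_left_cancel₀ hfE0
    calc fE * (h * (v : IwasawaAlgebra p)) = (h * fE) * v := by ring
      _ = g * v := by rw [← hgh]
      _ = fE := hv
      _ = fE * 1 := (mul_one fE).symm
  have hunit : IsUnit h := isUnit_iff_exists_inv.mpr ⟨_, hhv⟩
  obtain ⟨w, hw⟩ := PowerSeries.isUnit_iff_constantCoeff.mp hunit
  have hv0 : (((PowerSeries.constantCoeff h : ℤ_[p]) : ℚ_[p])).valuation = 0 := by
    rw [← hw]; exact valuation_coe_units_eq_zero p w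
  refine ⟨s, hsha, ?_⟩
  rw [hval, hv0, zero_add]

/-- **Rank one: Mazur's main conjecture ⟺ `ord_p #Ш_an = ord_p #Ш`** at a reducible good ordinary
`p ≥ 5` with `ord_{s=1} L(E,s) = 1`, modulo the Schneider certificate, granted the PUBLISHED named facts
Wuthrich Thm. 16 (`hW16`), Perrin-Riou–Schneider (`hS`), Perrin-Riou 1987 (`hPR`), modularity (`hmod`),
Gross–Zagier–Kolyvagin (`hGZK`). The rank-one analogue of `mainConjecture_iff_missingPPartAt`.
[cite: Wuthrich2014, Thm. 16 (p. 393) and §6 (p. 400)] [cite: PerrinRiou1987, §1.4 Cor. 1.8]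
[cite: BalakrishnanMullerStein2015, Thm. 1.7] -/
theorem mainConjecture_iff_missingPPartAt_of_rank_one (hW16 : charIdeal_dvd_padicLFunction)
    (hS : Schneider1985_order_charGenerator) (hPR : perrinRiou_rankOne_leadingTerms)
    (hmod : nonempty_modularParametrizationData)
    (hGZK : rank_eq_analyticRank_of_analyticRank_le_one)
    (W : WeierstrassCurve ℚ) [W.IsElliptic] [W.IsGloballyMinimal] (p : ℕ) [Fact p.Prime]
    (hp : 5 ≤ p) (hgood : W.HasGoodReductionAtPrime p) (hordp : ¬ (p : ℤ) ∣ W.frobeniusTrace p)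
    (hred : ¬ W.HasIrreducibleModPGaloisRep p) (han : W.analyticRank = 1)
    (hSch : ∀ Dh : PAdicHeightData W p, Dh.IsCanonical → SchneiderConjecture Dh) :
    (∀ (κ : ZpExtension ℚ p) (γ : Field.absoluteGaloisGroup ℚ),
        κ.IsCyclotomic → κ.IsTopGenerator γ → IsCyclotomicVariable p γ →
      ∀ [NeZero (W.conductorNorm ℤ)] (f : CuspForm (Gamma0 (W.conductorNorm ℤ)) 2),
        IsNewformOf W f → ∀ (ϖ : ℚ), (ϖ : ℝ) * W.realPeriodRat = plusPeriod f →
      ∀ (D : W.SelmerDualData κ γ), D.IsTorsion ∧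
        ∃ g : IwasawaAlgebra p, D.charIdeal = Ideal.span {g} ∧
          iwasawaToPowerSeries p g =
            PowerSeries.C (ϖ : ℚ_[p]) * padicLFunction f (unitRoot W p : ℚ_[p])) ↔
    Typed.MissingPPartAt W p := by
  constructor
  · exact missingPPartAt_of_mainConjecture_of_rank_one hS hPR hmod hGZK W p hp hgood hordp han hSch
  · intro h κ γ hκ hγ hγ' _ f hf ϖ hϖ D
    exact mainConjecture_of_missingLowerBoundAt_of_rank_one hW16 hS hPR hGZK W p hp hgood hordp hred
      han hSch (Typed.lower_and_upper_of_missingPPartAt W p h).1 hκ hγ hγ' hf D ϖ hϖ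

/-- **Rank one: Mazur's main conjecture ⟺ Miller's `BSD(E,p)`** (same setting, same facts, modulo the
Schneider certificate): the two open statements about such a pair `(E,p)` coincide on the published
record, exactly as in rank `0` (`mainConjecture_iff_bsdp`). [cite: Wuthrich2014, Thm. 16 (p. 393) and §6]
[cite: PerrinRiou1987, §1.4 Cor. 1.8] [cite: Miller2011LMS, Def. 1.1 (arXiv:1010.2431 p. 3)] -/
theorem mainConjecture_iff_bsdp_of_rank_one (hW16 : charIdeal_dvd_padicLFunction)
    (hS : Schneider1985_order_charGenerator) (hPR : perrinRiou_rankOne_leadingTerms)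
    (hmod : nonempty_modularParametrizationData)
    (hGZK : rank_eq_analyticRank_of_analyticRank_le_one)
    (W : WeierstrassCurve ℚ) [W.IsElliptic] [W.IsGloballyMinimal] (p : ℕ) [Fact p.Prime]
    (hp : 5 ≤ p) (hgood : W.HasGoodReductionAtPrime p) (hordp : ¬ (p : ℤ) ∣ W.frobeniusTrace p)
    (hred : ¬ W.HasIrreducibleModPGaloisRep p) (han : W.analyticRank = 1)
    (hSch : ∀ Dh : PAdicHeightData W p, Dh.IsCanonical → SchneiderConjecture Dh) :
    (∀ (κ : ZpExtension ℚ p) (γ : Field.absoluteGaloisGroup ℚ),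
        κ.IsCyclotomic → κ.IsTopGenerator γ → IsCyclotomicVariable p γ →
      ∀ [NeZero (W.conductorNorm ℤ)] (f : CuspForm (Gamma0 (W.conductorNorm ℤ)) 2),
        IsNewformOf W f → ∀ (ϖ : ℚ), (ϖ : ℝ) * W.realPeriodRat = plusPeriod f →
      ∀ (D : W.SelmerDualData κ γ), D.IsTorsion ∧
        ∃ g : IwasawaAlgebra p, D.charIdeal = Ideal.span {g} ∧
          iwasawaToPowerSeries p g =
            PowerSeries.C (ϖ : ℚ_[p]) * padicLFunction f (unitRoot W p : ℚ_[p])) ↔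
    BSDp W p := by
  rw [mainConjecture_iff_missingPPartAt_of_rank_one hW16 hS hPR hmod hGZK W p hp hgood hordp hred han
    hSch]
  haveI : Finite W.sha := (hGZK W han.le).2
  exact ⟨Typed.bsdp_of_missingPPartAt W p hGZK han.le, Typed.missingPPartAt_of_bsdp W p⟩

/-- **Rank one with `p ∤ #Ш(E/ℚ)_an`: the certificate gives BOTH `BSD(E,p)` and Mazur's main
conjecture.** If `#Ш(E/ℚ)_an` is a rational of `p`-adic valuation `0` (as at all 259 rank-one X1 pairs
of conductor `< 10⁴`), the lower bound `ord_p #Ш_an ≤ ord_p #Ш` is free, so (reducible good ordinary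
`p ≥ 5`, `ord_{s=1} L(E,s) = 1`, Schneider certificate, same published facts) Mazur's main conjecture
holds at every datum and `BSDp W p`. Lane lever: for such a pair the per-curve certificate is the
`p`-adic computation `[T¹]L_p(E,T) ≠ 0` (no descent). [cite: Wuthrich2014, Thm. 16 and §6]
[cite: PerrinRiou1987, §1.4 Cor. 1.8] [cite: Miller2011LMS, Def. 1.1 (arXiv:1010.2431 p. 3)] -/
theorem bsdp_and_mainConjecture_of_rank_one_of_shaAn_unit (hW16 : charIdeal_dvd_padicLFunction)
    (hS : Schneider1985_order_charGenerator) (hPR : perrinRiou_rankOne_leadingTerms)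
    (hmod : nonempty_modularParametrizationData)
    (hGZK : rank_eq_analyticRank_of_analyticRank_le_one)
    (W : WeierstrassCurve ℚ) [W.IsElliptic] [W.IsGloballyMinimal] (p : ℕ) [Fact p.Prime]
    (hp : 5 ≤ p) (hgood : W.HasGoodReductionAtPrime p) (hordp : ¬ (p : ℤ) ∣ W.frobeniusTrace p)
    (hred : ¬ W.HasIrreducibleModPGaloisRep p) (han : W.analyticRank = 1)
    (hSch : ∀ Dh : PAdicHeightData W p, Dh.IsCanonical → SchneiderConjecture Dh)
    (hunit : ∃ q : ℚ, shaAn W = (q : ℂ) ∧ padicValRat p q = 0) :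
    BSDp W p ∧
    (∀ (κ : ZpExtension ℚ p) (γ : Field.absoluteGaloisGroup ℚ),
        κ.IsCyclotomic → κ.IsTopGenerator γ → IsCyclotomicVariable p γ →
      ∀ [NeZero (W.conductorNorm ℤ)] (f : CuspForm (Gamma0 (W.conductorNorm ℤ)) 2),
        IsNewformOf W f → ∀ (ϖ : ℚ), (ϖ : ℝ) * W.realPeriodRat = plusPeriod f →
      ∀ (D : W.SelmerDualData κ γ), D.IsTorsion ∧
        ∃ g : IwasawaAlgebra p, D.charIdeal = Ideal.span {g} ∧
          iwasawaToPowerSeries p g =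
            PowerSeries.C (ϖ : ℚ_[p]) * padicLFunction f (unitRoot W p : ℚ_[p])) := by
  obtain ⟨q, hq, hv⟩ := hunit
  have hlow : Typed.MissingLowerBoundAt W p := ⟨q, hq, by rw [hv]; exact_mod_cast Nat.zero_le _⟩
  have hMC : ∀ (κ : ZpExtension ℚ p) (γ : Field.absoluteGaloisGroup ℚ),
        κ.IsCyclotomic → κ.IsTopGenerator γ → IsCyclotomicVariable p γ →
      ∀ [NeZero (W.conductorNorm ℤ)] (f : CuspForm (Gamma0 (W.conductorNorm ℤ)) 2),
        IsNewformOf W f → ∀ (ϖ : ℚ), (ϖ : ℝ) * W.realPeriodRat = plusPeriod f →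
      ∀ (D : W.SelmerDualData κ γ), D.IsTorsion ∧
        ∃ g : IwasawaAlgebra p, D.charIdeal = Ideal.span {g} ∧
          iwasawaToPowerSeries p g =
            PowerSeries.C (ϖ : ℚ_[p]) * padicLFunction f (unitRoot W p : ℚ_[p]) :=
    fun κ γ hκ hγ hγ' _ f hf ϖ hϖ D ↦
      mainConjecture_of_missingLowerBoundAt_of_rank_one hW16 hS hPR hGZK W p hp hgood hordp hred han
        hSch hlow hκ hγ hγ' hf D ϖ hϖ
  exact ⟨(mainConjecture_iff_bsdp_of_rank_one hW16 hS hPR hmod hGZK W p hp hgood hordp hred han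
    hSch).mp hMC, hMC⟩

end Literature.NumberTheory.EllipticCurves.Wuthrich2014

end
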